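import Mathlib
import HarnessLib
import Summits.MatrixMultiplication.MatrixMultiplication.Theorems.OutsiderSandwichToricCeiling

/-!
# OutsiderSandwich — toric ceiling of `cw₂^{⊠N}`, part 1: product frames, the parity certificate
and its leg fibres
(decomp-mm lens 4, gen 43, kernel K43-4a; THESES-FREE, `ω`-free; helper toward `LaserTangency`,
stmt-32268.  Part 2 `…ToricCeilingPow` proves the theorem: for `N ≥ 2` no diagonal with
`≥ 3^N - 1` triples is a combinatorial degeneration of `cw₂^{⊠N}` in any product basis.)

OBJECTS.  `Word N = Fin N → Fin 3` (points of a leg), `Tr3 N` (triples), a PRODUCT PATTERN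
`κ : Fin N → Bool` (coordinate `i` in the Coppersmith–Winograd basis if `κ i`, else in the
permutation basis `D a b c = [a, b, c pairwise distinct]`), the product frame `frame κ` (support of
the host in that basis), the set `derSet s t` of coordinates at which `t` is DERANGED from a star
`s` (all three legs differ), and the certificate `cert κ s` = frame triples with an ODD number of
deranged coordinates.

RESULTS.  `fibre_frame`: every leg fibre of `frame κ` has exactly `2^N` triples (it is
`∏ᵢ pairsⱼ (κ i) (p i)`, two slot pairs per coordinate — `card_fibre₁₂₃`, `pairs_card`).
`fibre_cert`: if every coordinate of the star is a permutation triple, `cert κ s` avoids the star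
words and covers every other word of every leg exactly `2^(N-1)` times — over `p ≠ sₗ` pick `i₀`
with `p i₀ ≠ sₗ i₀`; of the two slot pairs through `p i₀` exactly one is deranged (`pairs_mark`, a
finite check over `Bool × Fin 3⁴`), and swapping them is a parity-reversing involution of the fibre
(`card_odd_eq_half`); over `p = sₗ` nothing is deranged (`card_odd_eq_zero`).
-/

set_option linter.dupNamespace false

namespace Summit.MatrixMultiplication.MatrixMultiplication.Theorems.OutsiderSandwichToricCeilingPowFibres

open Finset
open Summit.MatrixMultiplication.MatrixMultiplication.Theorems.OutsiderSandwichToricCeiling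
  (cwSlot dSlot dslot_of_counts)

/-! ## §1 Objects -/

/-- Points of one leg of `cw₂^{⊠N}`: words of length `N` over `Fin 3`. [new] -/
abbrev Word (N : ℕ) := Fin N → Fin 3

/-- Triples of words (leg A, leg B, leg C). [new] -/
abbrev Tr3 (N : ℕ) := Word N × Word N × Word N

/-- The slot pattern of a basis flag: `true` = Coppersmith–Winograd basis, `false` = permutation
basis. [new] -/
def slotB (b : Bool) (x y z : Fin 3) : Bool := if b then cwSlot x y z else dSlot x y z

variable {N : ℕ}

/-- The PRODUCT FRAME of a pattern `κ`: support of `cw₂^{⊠N}` in the product basis `κ`. [new] -/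
def frame (κ : Fin N → Bool) : Finset (Tr3 N) :=
  univ.filter fun t => ∀ i, slotB (κ i) (t.1 i) (t.2.1 i) (t.2.2 i) = true

/-- The coordinates at which the triple `t` is DERANGED from the star `s` (all three legs differ).
[new] -/
def derSet (s t : Tr3 N) : Finset (Fin N) :=
  univ.filter fun i => t.1 i ≠ s.1 i ∧ t.2.1 i ≠ s.2.1 i ∧ t.2.2 i ≠ s.2.2 i

/-- THE CERTIFICATE `H_κ(s)`: frame triples with an odd number of deranged coordinates. [new] -/
def cert (κ : Fin N → Bool) (s : Tr3 N) : Finset (Tr3 N) :=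
  (frame κ).filter fun t => Odd #(derSet s t)

/-- Slot pairs completing the value `u` on leg A. [new] -/
def pairs₁ (b : Bool) (u : Fin 3) : Finset (Fin 3 × Fin 3) :=
  univ.filter fun q => slotB b u q.1 q.2 = true

/-- Slot pairs completing the value `u` on leg B. [new] -/
def pairs₂ (b : Bool) (u : Fin 3) : Finset (Fin 3 × Fin 3) :=
  univ.filter fun q => slotB b q.1 u q.2 = true

/-- Slot pairs completing the value `u` on leg C. [new] -/
def pairs₃ (b : Bool) (u : Fin 3) : Finset (Fin 3 × Fin 3) :=
  univ.filter fun q => slotB b q.1 q.2 u = true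

/-- Value count of `α` at coordinate `i` over the three legs of a triple. [new] -/
def cnt (i : Fin N) (α : Fin 3) (t : Tr3 N) : ℕ :=
  (if t.1 i = α then 1 else 0) + (if t.2.1 i = α then 1 else 0) + (if t.2.2 i = α then 1 else 0)

/-! ## §2 The finite facts about one coordinate (`decide` over `Bool × Fin 3⁴`) -/

/-- Two slot pairs through every value, on every leg, in both patterns. [new] -/
theorem pairs_card : ∀ b : Bool, ∀ u : Fin 3,
    #(pairs₁ b u) = 2 ∧ #(pairs₂ b u) = 2 ∧ #(pairs₃ b u) = 2 := by decide

/-- Off a star value, exactly ONE of the two slot pairs is deranged from the star. [new] -/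
theorem pairs_mark : ∀ b : Bool, ∀ x y z u : Fin 3, dSlot x y z = true →
    (u ≠ x → #{q ∈ pairs₁ b u | q.1 ≠ y ∧ q.2 ≠ z} = 1) ∧
    (u ≠ y → #{q ∈ pairs₂ b u | q.1 ≠ x ∧ q.2 ≠ z} = 1) ∧
    (u ≠ z → #{q ∈ pairs₃ b u | q.1 ≠ x ∧ q.2 ≠ y} = 1) := by decide

/-- Value counts of one slot: `0` exactly once; in the permutation pattern every value once, in the
cw pattern `1, 2` an even number of times. [new] -/
theorem slot_cnt : ∀ b : Bool, ∀ x y z : Fin 3, slotB b x y z = true → ∀ α : Fin 3,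
    (α = 0 ∨ b = false →
      (if x = α then 1 else 0) + (if y = α then 1 else 0) + (if z = α then 1 else 0) = 1) ∧
    (b = true → α ≠ 0 → Even ((if x = α then 1 else 0) + (if y = α then 1 else 0) +
      (if z = α then 1 else 0))) := by decide

/-- A value of `Fin 3` is exactly one of `0, 1, 2`. [folklore] -/
theorem ind_sum : ∀ v : Fin 3, (if v = (0 : Fin 3) then 1 else 0) + (if v = (1 : Fin 3) then 1 else 0)
    + (if v = (2 : Fin 3) then 1 else 0) = 1 := by decide

/-- Values hitting each `α` exactly once are pairwise distinct. [folklore] -/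
theorem dslot_of_counts_one : ∀ x y z : Fin 3, (∀ α : Fin 3,
    (if x = α then 1 else 0) + (if y = α then 1 else 0) + (if z = α then 1 else 0) = 1) →
    dSlot x y z = true := by decide

/-! ## §3 The parity-reversing involution (abstract) -/

section Parity

variable {X : Type*} [DecidableEq X]

/-- Marked coordinates of a choice function. [new] -/
def markSet (mk : Fin N → X → Bool) (q : Fin N → X) : Finset (Fin N) :=
  univ.filter fun i => mk i (q i) = true

omit [DecidableEq X] in
/-- `∏ᵢ Sᵢ` has `2^N` elements when every `Sᵢ` has two. [folklore] -/
theorem card_piFinset_two (S : Fin N → Finset X) (h2 : ∀ i, #(S i) = 2) :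
    #(Fintype.piFinset S) = 2 ^ N := by
  rw [Fintype.card_piFinset, Finset.prod_congr rfl fun i _ => h2 i, Finset.prod_const,
    Finset.card_univ, Fintype.card_fin]

omit [DecidableEq X] in
/-- No marks anywhere: no choice has an odd number of marks. [new] -/
theorem card_odd_eq_zero (S : Fin N → Finset X) (mk : Fin N → X → Bool)
    (hZ : ∀ i, ∀ q ∈ S i, mk i q = false) :
    #{q ∈ Fintype.piFinset S | Odd #(markSet mk q)} = 0 := by
  refine Finset.card_eq_zero.mpr (Finset.filter_eq_empty_iff.mpr fun q hq => ?_)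
  have hM : markSet mk q = ∅ := Finset.filter_eq_empty_iff.mpr fun i _ => by
    rw [hZ i (q i) (Fintype.mem_piFinset.mp hq i)]; decide
  rw [hM, Finset.card_empty]; decide

/-- One coordinate `i₀` whose two options carry exactly one mark: swapping them is a
parity-reversing involution, so exactly half of the `2^N` choices have an odd number of marks. [new] -/
theorem card_odd_eq_half (S : Fin N → Finset X) (mk : Fin N → X → Bool) (h2 : ∀ i, #(S i) = 2)
    (i₀ : Fin N) (h1 : #{q ∈ S i₀ | mk i₀ q = true} = 1) :
    #{q ∈ Fintype.piFinset S | Odd #(markSet mk q)} = 2 ^ (N - 1) := by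
  classical
  obtain ⟨qp, hqp⟩ := Finset.card_eq_one.mp h1
  have hrest : #{q ∈ S i₀ | ¬ mk i₀ q = true} = 1 := by
    have := Finset.card_filter_add_card_filter_not (s := S i₀) (fun q => mk i₀ q = true)
    rw [h2, h1] at this; omega
  obtain ⟨qm, hqm⟩ := Finset.card_eq_one.mp hrest
  have hp : qp ∈ S i₀ ∧ mk i₀ qp = true :=
    Finset.mem_filter.mp (by rw [hqp]; exact Finset.mem_singleton_self _)
  have hm : qm ∈ S i₀ ∧ ¬ mk i₀ qm = true :=
    Finset.mem_filter.mp (by rw [hqm]; exact Finset.mem_singleton_self _)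
  have hpm : qp ≠ qm := fun e => hm.2 (e ▸ hp.2)
  -- every option at `i₀` is `qp` or `qm`
  have dich : ∀ q ∈ S i₀, q ≠ qp → q = qm := fun q hq hne => by
    by_cases hk : mk i₀ q = true
    · exact absurd (Finset.mem_singleton.mp (hqp ▸ Finset.mem_filter.mpr ⟨hq, hk⟩)) hne
    · exact Finset.mem_singleton.mp (hqm ▸ Finset.mem_filter.mpr ⟨hq, hk⟩)
  -- the flip
  set φ : (Fin N → X) → (Fin N → X) :=
    fun q => Function.update q i₀ (if q i₀ = qp then qm else qp) with hφ
  have φ_at : ∀ q, φ q i₀ = if q i₀ = qp then qm else qp := fun q => by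
    simp [hφ]
  have φ_ne : ∀ q i, i ≠ i₀ → φ q i = q i := fun q i hi => by
    simp [hφ, Function.update_of_ne hi]
  have φ_mem : ∀ q ∈ Fintype.piFinset S, φ q ∈ Fintype.piFinset S := fun q hq => by
    refine Fintype.mem_piFinset.mpr fun i => ?_
    by_cases hi : i = i₀
    · subst hi; rw [φ_at]; split_ifs
      · exact hm.1
      · exact hp.1
    · rw [φ_ne q i hi]; exact Fintype.mem_piFinset.mp hq i
  have φ_inv : ∀ q ∈ Fintype.piFinset S, φ (φ q) = q := fun q hq => by
    have hq₀ := Fintype.mem_piFinset.mp hq i₀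
    funext i
    by_cases hi : i = i₀
    · subst hi
      rw [φ_at, φ_at]
      by_cases e : q i = qp
      · rw [if_pos e, if_neg hpm.symm, e]
      · rw [if_neg e, if_pos rfl, dich _ hq₀ e]
    · rw [φ_ne _ i hi, φ_ne _ i hi]
  -- the flip reverses the parity of the number of marks
  have φ_marks : ∀ q ∈ Fintype.piFinset S,
      (Odd #(markSet mk (φ q)) ↔ ¬ Odd #(markSet mk q)) := fun q hq => by
    have hq₀ := Fintype.mem_piFinset.mp hq i₀
    by_cases e : q i₀ = qp
    · -- mark at `i₀` removed
      have hmem : i₀ ∈ markSet mk q := Finset.mem_filter.mpr ⟨Finset.mem_univ _, e ▸ hp.2⟩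
      have hM : markSet mk (φ q) = (markSet mk q).erase i₀ := by
        ext i
        simp only [markSet, Finset.mem_filter, Finset.mem_univ, true_and, Finset.mem_erase]
        by_cases hi : i = i₀
        · subst hi; rw [φ_at, if_pos e]; simp [hm.2]
        · rw [φ_ne q i hi]; simp [hi]
      rw [hM, ← Finset.card_erase_add_one hmem, Nat.odd_add_one, not_not]
    · -- mark at `i₀` added
      have hqm' : q i₀ = qm := dich _ hq₀ e
      have hnot : i₀ ∉ markSet mk q := fun h => hm.2 (hqm' ▸ (Finset.mem_filter.mp h).2)
      have hM : markSet mk (φ q) = insert i₀ (markSet mk q) := by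
        ext i
        simp only [markSet, Finset.mem_filter, Finset.mem_univ, true_and, Finset.mem_insert]
        by_cases hi : i = i₀
        · subst hi; rw [φ_at, if_neg e]; simp [hp.2]
        · rw [φ_ne q i hi]; simp [hi]
      rw [hM, Finset.card_insert_of_notMem hnot, Nat.odd_add_one]
  -- odd and even parts are in bijection
  have heq : #{q ∈ Fintype.piFinset S | Odd #(markSet mk q)} =
      #{q ∈ Fintype.piFinset S | ¬ Odd #(markSet mk q)} := by
    refine Finset.card_bij' (fun q _ => φ q) (fun q _ => φ q) (fun q hq => ?_) (fun q hq => ?_)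
      (fun q hq => φ_inv q (Finset.mem_filter.mp hq).1) (fun q hq => φ_inv q (Finset.mem_filter.mp hq).1)
    · obtain ⟨hq, hodd⟩ := Finset.mem_filter.mp hq
      refine Finset.mem_filter.mpr ⟨φ_mem q hq, fun h => ?_⟩
      exact (φ_marks q hq).mp h hodd
    · obtain ⟨hq, hev⟩ := Finset.mem_filter.mp hq
      refine Finset.mem_filter.mpr ⟨φ_mem q hq, ?_⟩
      have h := φ_marks (φ q) (φ_mem q hq)
      rw [φ_inv q hq] at h
      by_contra hno; exact hev (by tauto)
  have htot := Finset.card_filter_add_card_filter_not (s := Fintype.piFinset S)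
    (fun q => Odd #(markSet mk q))
  rw [card_piFinset_two S h2, ← heq] at htot
  have h2N : 2 ^ N = 2 ^ (N - 1) * 2 := by
    rw [← pow_succ, Nat.sub_add_cancel (Fin.pos i₀)]
  omega

end Parity

/-! ## §4 Leg fibres of the frame and of the certificate -/

/-- Leg-A fibre of the frame over the word `p`, refined by a condition on the completing pairs, is
counted on `∏ᵢ pairs₁ (κ i) (p i)`. [new] -/
theorem card_fibre₁ (κ : Fin N → Bool) (p : Word N) (Q : (Fin N → Fin 3 × Fin 3) → Prop)
    [DecidablePred Q] :
    #{t ∈ frame κ | t.1 = p ∧ Q (fun i => (t.2.1 i, t.2.2 i))} =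
      #{q ∈ Fintype.piFinset (fun i => pairs₁ (κ i) (p i)) | Q q} := by
  refine Finset.card_bij' (fun t _ => fun i => (t.2.1 i, t.2.2 i))
    (fun q _ => (p, fun i => (q i).1, fun i => (q i).2)) (fun t ht => ?_) (fun q hq => ?_)
    (fun t ht => ?_) (fun q hq => ?_)
  · simp only [frame, Finset.mem_filter, Finset.mem_univ, true_and] at ht
    obtain ⟨hfr, hp, hQ⟩ := ht
    subst hp
    refine Finset.mem_filter.mpr ⟨Fintype.mem_piFinset.mpr fun i => ?_, hQ⟩
    exact Finset.mem_filter.mpr ⟨Finset.mem_univ _, hfr i⟩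
  · simp only [Finset.mem_filter, Fintype.mem_piFinset, pairs₁, Finset.mem_univ, true_and] at hq
    refine Finset.mem_filter.mpr ⟨Finset.mem_filter.mpr ⟨Finset.mem_univ _, fun i => hq.1 i⟩, rfl, ?_⟩
    simpa only [Prod.mk.eta] using hq.2
  · simp only [frame, Finset.mem_filter, Finset.mem_univ, true_and] at ht
    obtain ⟨-, hp, -⟩ := ht
    subst hp; rfl
  · funext i; simp

/-- Leg-B analogue of `card_fibre₁`. [new] -/
theorem card_fibre₂ (κ : Fin N → Bool) (p : Word N) (Q : (Fin N → Fin 3 × Fin 3) → Prop)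
    [DecidablePred Q] :
    #{t ∈ frame κ | t.2.1 = p ∧ Q (fun i => (t.1 i, t.2.2 i))} =
      #{q ∈ Fintype.piFinset (fun i => pairs₂ (κ i) (p i)) | Q q} := by
  refine Finset.card_bij' (fun t _ => fun i => (t.1 i, t.2.2 i))
    (fun q _ => (fun i => (q i).1, p, fun i => (q i).2)) (fun t ht => ?_) (fun q hq => ?_)
    (fun t ht => ?_) (fun q hq => ?_)
  · simp only [frame, Finset.mem_filter, Finset.mem_univ, true_and] at ht
    obtain ⟨hfr, hp, hQ⟩ := ht
    subst hp
    refine Finset.mem_filter.mpr ⟨Fintype.mem_piFinset.mpr fun i => ?_, hQ⟩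
    exact Finset.mem_filter.mpr ⟨Finset.mem_univ _, hfr i⟩
  · simp only [Finset.mem_filter, Fintype.mem_piFinset, pairs₂, Finset.mem_univ, true_and] at hq
    refine Finset.mem_filter.mpr ⟨Finset.mem_filter.mpr ⟨Finset.mem_univ _, fun i => hq.1 i⟩, rfl, ?_⟩
    simpa only [Prod.mk.eta] using hq.2
  · simp only [frame, Finset.mem_filter, Finset.mem_univ, true_and] at ht
    obtain ⟨-, hp, -⟩ := ht
    subst hp; rfl
  · funext i; simp

/-- Leg-C analogue of `card_fibre₁`. [new] -/
theorem card_fibre₃ (κ : Fin N → Bool) (p : Word N) (Q : (Fin N → Fin 3 × Fin 3) → Prop)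
    [DecidablePred Q] :
    #{t ∈ frame κ | t.2.2 = p ∧ Q (fun i => (t.1 i, t.2.1 i))} =
      #{q ∈ Fintype.piFinset (fun i => pairs₃ (κ i) (p i)) | Q q} := by
  refine Finset.card_bij' (fun t _ => fun i => (t.1 i, t.2.1 i))
    (fun q _ => (fun i => (q i).1, fun i => (q i).2, p)) (fun t ht => ?_) (fun q hq => ?_)
    (fun t ht => ?_) (fun q hq => ?_)
  · simp only [frame, Finset.mem_filter, Finset.mem_univ, true_and] at ht
    obtain ⟨hfr, hp, hQ⟩ := ht
    subst hp
    refine Finset.mem_filter.mpr ⟨Fintype.mem_piFinset.mpr fun i => ?_, hQ⟩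
    exact Finset.mem_filter.mpr ⟨Finset.mem_univ _, hfr i⟩
  · simp only [Finset.mem_filter, Fintype.mem_piFinset, pairs₃, Finset.mem_univ, true_and] at hq
    refine Finset.mem_filter.mpr ⟨Finset.mem_filter.mpr ⟨Finset.mem_univ _, fun i => hq.1 i⟩, rfl, ?_⟩
    simpa only [Prod.mk.eta] using hq.2
  · simp only [frame, Finset.mem_filter, Finset.mem_univ, true_and] at ht
    obtain ⟨-, hp, -⟩ := ht
    subst hp; rfl
  · funext i; simp

/-- Every leg fibre of the product frame has exactly `2^N` triples. [new] -/
theorem fibre_frame (κ : Fin N → Bool) (p : Word N) :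
    #{t ∈ frame κ | t.1 = p} = 2 ^ N ∧ #{t ∈ frame κ | t.2.1 = p} = 2 ^ N ∧
      #{t ∈ frame κ | t.2.2 = p} = 2 ^ N := by
  refine ⟨?_, ?_, ?_⟩
  · have h := card_fibre₁ κ p (fun _ => True)
    simp only [and_true] at h
    rw [Finset.filter_true_of_mem fun _ _ => trivial] at h
    rw [h]; exact card_piFinset_two _ fun i => (pairs_card (κ i) (p i)).1
  · have h := card_fibre₂ κ p (fun _ => True)
    simp only [and_true] at h
    rw [Finset.filter_true_of_mem fun _ _ => trivial] at h
    rw [h]; exact card_piFinset_two _ fun i => (pairs_card (κ i) (p i)).2.1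
  · have h := card_fibre₃ κ p (fun _ => True)
    simp only [and_true] at h
    rw [Finset.filter_true_of_mem fun _ _ => trivial] at h
    rw [h]; exact card_piFinset_two _ fun i => (pairs_card (κ i) (p i)).2.2

/-- The certificate avoids the star words and covers every other word exactly `2^(N-1)` times, on
each leg. [new] -/
theorem fibre_cert (κ : Fin N → Bool) {s : Tr3 N}
    (hs : ∀ i, dSlot (s.1 i) (s.2.1 i) (s.2.2 i) = true) (p : Word N) :
    #{t ∈ cert κ s | t.1 = p} = (if p = s.1 then 0 else 2 ^ (N - 1)) ∧
    #{t ∈ cert κ s | t.2.1 = p} = (if p = s.2.1 then 0 else 2 ^ (N - 1)) ∧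
    #{t ∈ cert κ s | t.2.2 = p} = (if p = s.2.2 then 0 else 2 ^ (N - 1)) := by
  refine ⟨?_, ?_, ?_⟩
  · let mk : Fin N → Fin 3 × Fin 3 → Bool :=
      fun i q => decide (p i ≠ s.1 i ∧ q.1 ≠ s.2.1 i ∧ q.2 ≠ s.2.2 i)
    have step : #{t ∈ cert κ s | t.1 = p} =
        #{t ∈ frame κ | t.1 = p ∧ Odd #(markSet mk (fun i => (t.2.1 i, t.2.2 i)))} := by
      rw [cert, Finset.filter_filter]
      congr 1; apply Finset.filter_congr; intro t _
      constructor
      · rintro ⟨hodd, rfl⟩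
        refine ⟨rfl, ?_⟩; convert hodd using 3; ext i; simp [markSet, derSet, mk]
      · rintro ⟨rfl, hodd⟩
        refine ⟨?_, rfl⟩; convert hodd using 3; ext i; simp [markSet, derSet, mk]
    rw [step, card_fibre₁ κ p (fun q => Odd #(markSet mk q))]
    split_ifs with hp
    · refine card_odd_eq_zero _ _ fun i q _ => ?_
      simp [mk, hp]
    · obtain ⟨i₀, hi₀⟩ : ∃ i, p i ≠ s.1 i := by
        by_contra h; push Not at h; exact hp (funext h)
      refine card_odd_eq_half _ _ (fun i => (pairs_card (κ i) (p i)).1) i₀ ?_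
      rw [← ((pairs_mark (κ i₀) (s.1 i₀) (s.2.1 i₀) (s.2.2 i₀) (p i₀) (hs i₀)).1 hi₀)]
      congr 1; apply Finset.filter_congr; intro q _; simp [mk, hi₀]
  · let mk : Fin N → Fin 3 × Fin 3 → Bool :=
      fun i q => decide (q.1 ≠ s.1 i ∧ p i ≠ s.2.1 i ∧ q.2 ≠ s.2.2 i)
    have step : #{t ∈ cert κ s | t.2.1 = p} =
        #{t ∈ frame κ | t.2.1 = p ∧ Odd #(markSet mk (fun i => (t.1 i, t.2.2 i)))} := by
      rw [cert, Finset.filter_filter]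
      congr 1; apply Finset.filter_congr; intro t _
      constructor
      · rintro ⟨hodd, rfl⟩
        refine ⟨rfl, ?_⟩; convert hodd using 3; ext i; simp [markSet, derSet, mk]
      · rintro ⟨rfl, hodd⟩
        refine ⟨?_, rfl⟩; convert hodd using 3; ext i; simp [markSet, derSet, mk]
    rw [step, card_fibre₂ κ p (fun q => Odd #(markSet mk q))]
    split_ifs with hp
    · refine card_odd_eq_zero _ _ fun i q _ => ?_
      simp [mk, hp]
    · obtain ⟨i₀, hi₀⟩ : ∃ i, p i ≠ s.2.1 i := by
        by_contra h; push Not at h; exact hp (funext h)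
      refine card_odd_eq_half _ _ (fun i => (pairs_card (κ i) (p i)).2.1) i₀ ?_
      rw [← ((pairs_mark (κ i₀) (s.1 i₀) (s.2.1 i₀) (s.2.2 i₀) (p i₀) (hs i₀)).2.1 hi₀)]
      congr 1; apply Finset.filter_congr; intro q _; simp [mk, hi₀]
  · let mk : Fin N → Fin 3 × Fin 3 → Bool :=
      fun i q => decide (q.1 ≠ s.1 i ∧ q.2 ≠ s.2.1 i ∧ p i ≠ s.2.2 i)
    have step : #{t ∈ cert κ s | t.2.2 = p} =
        #{t ∈ frame κ | t.2.2 = p ∧ Odd #(markSet mk (fun i => (t.1 i, t.2.1 i)))} := by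
      rw [cert, Finset.filter_filter]
      congr 1; apply Finset.filter_congr; intro t _
      constructor
      · rintro ⟨hodd, rfl⟩
        refine ⟨rfl, ?_⟩; convert hodd using 3; ext i; simp [markSet, derSet, mk]
      · rintro ⟨rfl, hodd⟩
        refine ⟨?_, rfl⟩; convert hodd using 3; ext i; simp [markSet, derSet, mk]
    rw [step, card_fibre₃ κ p (fun q => Odd #(markSet mk q))]
    split_ifs with hp
    · refine card_odd_eq_zero _ _ fun i q _ => ?_
      simp [mk, hp]
    · obtain ⟨i₀, hi₀⟩ : ∃ i, p i ≠ s.2.2 i := by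
        by_contra h; push Not at h; exact hp (funext h)
      refine card_odd_eq_half _ _ (fun i => (pairs_card (κ i) (p i)).2.2) i₀ ?_
      rw [← ((pairs_mark (κ i₀) (s.1 i₀) (s.2.1 i₀) (s.2.2 i₀) (p i₀) (hs i₀)).2.2 hi₀)]
      congr 1; apply Finset.filter_congr; intro q _; simp [mk, hi₀]

end Summit.MatrixMultiplication.MatrixMultiplication.Theorems.OutsiderSandwichToricCeilingPowFibres
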